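import Literature.NumberTheory.LFunctions.RayClassFunctionalEquation
import Literature.NumberTheory.LFunctions.RayClassLSeriesGrowth
import Literature.NumberTheory.LFunctions.DedekindZetaEntireConvexity
import HarnessLib

/-!
# Hecke `L`-series of primitive ray class characters: the functional equation on `Re s = −1/2` in modulus

Topic `Literature/NumberTheory/LFunctions`; namespace `Literature.NumberTheory.LFunctions`.  Pure-proof
companion of `RayClassFunctionalEquation.lean` (Hecke's functional equation
`Λ(χ, 1 − s) = W(χ) Λ(χ̄, s)`, Neukirch VII (8.6), with `Λ(χ, s) = (|d_K| 𝔑(𝔪))^{s/2} L_∞(χ, s) L(χ, s)`,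
`L_∞ = rayClassGammaFactor`) and of `DedekindZetaEntireConvexity.lean` (the device of Rademacher 1959 §5: on
the line `Re s = −1/2` one has `1 − s = s̄ + 2`, so the Gamma quotients have EXACT modulus by
`Γ_ℝ(w+2) = Γ_ℝ(w) w/2π`, `Γ_ℂ(w+1) = Γ_ℂ(w) w/2π`, `|Γ(w̄)| = |Γ(w)|`).  Everything here is PROVED; no
definition and no named fact is introduced.

For a primitive ray class character `χ mod 𝔪` (`𝔪 ≠ 0`) of sign type `p`, and ANY entire function `L` which
agrees with the `L`-series `L(χ, s)` on `Re s > 1` (Hecke's continuation; unique):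

* `norm_rayClassLSeries_le_exp` — the trivial bound `|L(χ, s)| ≤ e^{n_K/(σ−1)}` for `σ = Re s > 1`;
* `norm_rayClassGammaFactor_one_sub_of_re_eq_neg_half` — for `Re s = −1/2`:
  `|L_∞(χ, 1 − s)| = |L_∞(χ, s)| · ∏_{w real} |s + p_w|/2π · ∏_{w complex} |s||s+1|/(2π)²`;
* `continuation_eq_of_ne` — off `{0, 1}`: `L(s) = W · Λ'(1 − s) · L_∞(χ, s)⁻¹ (|d_K|𝔑𝔪)^{-s/2}` where
  `Λ'` continues `Λ(χ̄, ·)` (identity theorem on `ℂ ∖ {0,1}` for `L` and `Λ(χ, s) L_∞(χ,s)⁻¹ (|d_K|𝔑𝔪)^{-s/2}`);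
* `norm_continuation_eq_of_re_eq_neg_half` — **the functional equation on `Re s = −1/2`, in modulus**:
  `|L(s)| = |d_K| 𝔑(𝔪) · ∏_{w real} |s + p_w|/2π · ∏_{w complex} |s||s+1|/(2π)² · |L(χ̄, 1 − s)|`;
* `norm_continuation_le_of_re_eq_neg_half` — hence `|L(s)| ≤ |d_K| 𝔑(𝔪) e^{2n_K} |s + 5/2|^{n_K}` there.

## References

* J. Neukirch, *Algebraic Number Theory*, Grundlehren 322, Springer 1999, Ch. VII §8 (8.5)–(8.6). [NeukirchANT1999]
* H. Rademacher, *On the Phragmén–Lindelöf theorem and some applications*, Math. Z. 72 (1959), 192–204, §5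
  Theorem 5 (Hecke `L`-functions). [Rademacher1959]
-/

noncomputable section

open Complex NumberField NumberField.InfinitePlace NumberField.Units IsDedekindDomain Filter Topology Set Metric
open scoped NumberField nonZeroDivisors
open scoped Classical

namespace Literature.NumberTheory.LFunctions

variable {K : Type*} [Field K] [NumberField K]
variable {𝔪 : Ideal (𝓞 K)} {ψ : HeightOneSpectrum (𝓞 K) → ℂ} {p : Finset {w : InfinitePlace K // IsReal w}}

/-! ### The trivial bound on `Re s > 1` -/

/-- **`|L(χ, s)| ≤ e^{n_K/(σ−1)}` for `σ = Re s > 1`** (termwise `|χ(𝔞)| ≤ 1`, `Σ_𝔞 𝔑𝔞^{−σ} = ζ_K(σ) ≤ e^{n_K/(σ−1)}`,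
the tree's `norm_dedekindZeta_le_exp_finrank_div`). [cite: NeukirchANT1999, Ch. VII §8 (8.1) Proposition] -/
theorem norm_rayClassLSeries_le_exp (h𝔪 : 𝔪 ≠ ⊥)
    (hψ1 : ∀ v : HeightOneSpectrum (𝓞 K), ¬ 𝔪 ≤ v.asIdeal → ‖ψ v‖ ≤ 1) {s : ℂ} (hs : 1 < s.re) :
    ‖rayClassLSeries 𝔪 ψ s‖ ≤ Real.exp (Module.finrank ℚ K / (s.re - 1)) := by
  have hσ : 1 < ((s.re : ℂ)).re := by simpa using hs
  have hs0 : -s ≠ 0 := neg_ne_zero.mpr fun h ↦ by rw [h, Complex.zero_re] at hs; linarith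
  have hσ0 : -((s.re : ℝ) : ℂ) ≠ 0 := by
    rw [neg_ne_zero, Ne, Complex.ofReal_eq_zero]; linarith
  -- pointwise: `‖𝔑𝔞^{-s}‖ = Re 𝔑𝔞^{-σ}` (both `0` at the zero ideal)
  have hpt : ∀ I : Ideal (𝓞 K), ‖((Ideal.absNorm I : ℕ) : ℂ) ^ (-s)‖ =
      (((Ideal.absNorm I : ℕ) : ℂ) ^ (-((s.re : ℝ) : ℂ))).re := by
    intro I
    rcases Nat.eq_zero_or_pos (Ideal.absNorm I) with h0 | hpos
    · rw [h0, Nat.cast_zero, Complex.zero_cpow hs0, Complex.zero_cpow hσ0, norm_zero, Complex.zero_re]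
    · rw [Complex.norm_natCast_cpow_of_pos hpos, Complex.neg_re, ← Complex.ofReal_natCast, ← Complex.ofReal_neg,
        ← Complex.ofReal_cpow (Nat.cast_nonneg _), Complex.ofReal_re]
  have hgsum : HasSum (fun I : Ideal (𝓞 K) ↦ ‖((Ideal.absNorm I : ℕ) : ℂ) ^ (-s)‖)
      (dedekindZeta K (s.re : ℂ)).re := by
    have := (Literature.NumberTheory.LFunctions.hasSum_absNorm_cpow K hσ).mapL Complex.reCLM
    simp only [Complex.reCLM_apply] at this
    exact this.congr_fun fun I ↦ hpt I
  have hterm : ∀ I : Ideal (𝓞 K), ‖rayClassCoeff 𝔪 ψ I * ((Ideal.absNorm I : ℕ) : ℂ) ^ (-s)‖ ≤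
      ‖((Ideal.absNorm I : ℕ) : ℂ) ^ (-s)‖ := fun I ↦ by
    rw [norm_mul]; exact mul_le_of_le_one_left (norm_nonneg _) (norm_rayClassCoeff_le_one h𝔪 hψ1 I)
  have h1 : ‖rayClassLSeries 𝔪 ψ s‖ ≤ ∑' I : Ideal (𝓞 K), ‖((Ideal.absNorm I : ℕ) : ℂ) ^ (-s)‖ := by
    unfold rayClassLSeries
    exact (norm_tsum_le_tsum_norm (summable_norm_rayClassCoeff_mul h𝔪 hψ1 hs)).trans
      ((summable_norm_rayClassCoeff_mul h𝔪 hψ1 hs).tsum_le_tsum hterm hgsum.summable)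
  calc ‖rayClassLSeries 𝔪 ψ s‖ ≤ ∑' I : Ideal (𝓞 K), ‖((Ideal.absNorm I : ℕ) : ℂ) ^ (-s)‖ := h1
    _ = (dedekindZeta K (s.re : ℂ)).re := hgsum.tsum_eq
    _ ≤ ‖dedekindZeta K (s.re : ℂ)‖ := Complex.re_le_norm _
    _ ≤ Real.exp (Module.finrank ℚ K / (s.re - 1)) := by
        have h := NumberField.norm_dedekindZeta_le_exp_finrank_div K (s := (s.re : ℂ)) (by simpa using hs)
        simpa using h

/-! ### The Gamma factor: inverse, non-vanishing, modulus on `Re s = −1/2` -/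

variable (K) in
/-- `L_∞(χ, ·)⁻¹` is entire (`L_∞ = 2^{r₂} A_p(s/2)`, `A_p⁻¹` entire). [folklore] -/
private theorem differentiable_inv_rayClassGammaFactor (p : Finset {w : InfinitePlace K // IsReal w}) :
    Differentiable ℂ fun s : ℂ ↦ (rayClassGammaFactor K p s)⁻¹ := by
  have heq : (fun s : ℂ ↦ (rayClassGammaFactor K p s)⁻¹) =
      fun s ↦ ((2 : ℂ) ^ nrComplexPlaces K)⁻¹ * (NumberField.gammaFactorCP K p (s / 2))⁻¹ := by
    funext s; rw [rayClassGammaFactor_eq, mul_inv]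
  rw [heq]
  exact (differentiable_const _).mul
    ((NumberField.differentiable_inv_gammaFactorCP p).comp (differentiable_id.div_const 2))

/-- `L_∞(χ, s) ≠ 0` for `Re s > 0`. [folklore] -/
private theorem rayClassGammaFactor_ne_zero_of_re_pos (p : Finset {w : InfinitePlace K // IsReal w}) {s : ℂ}
    (hs : 0 < s.re) : rayClassGammaFactor K p s ≠ 0 := by
  rw [rayClassGammaFactor_eq]
  refine mul_ne_zero (pow_ne_zero _ two_ne_zero) (NumberField.gammaFactorCP_ne_zero p ?_)
  simp only [Complex.div_ofNat_re]; linarith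

/-- `L_∞(χ, s) ≠ 0` for `Re s = −1/2` (no `Γ`-pole there). [folklore] -/
private theorem rayClassGammaFactor_ne_zero_of_re_eq_neg_half (p : Finset {w : InfinitePlace K // IsReal w})
    {s : ℂ} (hs : s.re = -1 / 2) : rayClassGammaFactor K p s ≠ 0 := by
  obtain ⟨hsZ, hs0, hs1⟩ := ne_int_of_re_eq_neg_half hs
  unfold rayClassGammaFactor
  refine mul_ne_zero (Finset.prod_ne_zero_iff.mpr fun w _ ↦ ?_) (Finset.prod_ne_zero_iff.mpr fun w _ ↦ ?_)
  · rw [Ne, Gammaℝ_eq_zero_iff]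
    rintro ⟨n, hn⟩
    have h1 := congrArg Complex.re hn
    simp only [Complex.add_re, hs, Complex.mul_re, Complex.ofReal_re, Complex.ofReal_im, Complex.neg_re] at h1
    norm_num at h1
    -- `-1/2 + 2 h_w = -2n` with `h_w ∈ {0, 1/2}`
    have hh : NumberField.halfWeight K p w.1 = 0 ∨ NumberField.halfWeight K p w.1 = 1 / 2 := by
      unfold NumberField.halfWeight; split_ifs <;> simp
    rcases hh with h0 | h0 <;> rw [h0] at h1
    · have : (2 * n : ℝ) = 1 / 2 := by linarith
      have h2 : (4 * n : ℝ) = 1 := by linarith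
      have h3 : (4 * n : ℕ) = 1 := by exact_mod_cast h2
      omega
    · have h2 : (4 * n : ℝ) = -1 := by linarith
      have h3 : (4 * (n : ℤ) : ℤ) = -1 := by exact_mod_cast h2
      omega
  · rw [Gammaℂ_def]
    refine mul_ne_zero (mul_ne_zero two_ne_zero ?_) (Complex.Gamma_ne_zero fun m hm ↦ hsZ (-m) ?_)
    · rw [Ne, cpow_eq_zero_iff, not_and_or]
      exact Or.inl (mul_ne_zero two_ne_zero (ofReal_ne_zero.mpr Real.pi_ne_zero))
    · rw [hm]; push_cast; ring

/-- **The Gamma factor on `Re s = −1/2`: exact modulus of `L_∞(χ, 1 − s)`**: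
`|L_∞(χ, 1 − s)| = |L_∞(χ, s)| · ∏_{w real} |s + p_w|/2π · ∏_{w complex} |s| |s+1|/(2π)²`
(`1 − s = s̄ + 2`, `Γ_ℝ(w + 2) = Γ_ℝ(w) w/2π`, `Γ_ℂ(w + 1) = Γ_ℂ(w) w/2π`, `|Γ(w̄)| = |Γ(w)|`).
[cite: Rademacher1959, §5 (proof of Theorem 5)] -/
theorem norm_rayClassGammaFactor_one_sub_of_re_eq_neg_half (p : Finset {w : InfinitePlace K // IsReal w})
    {s : ℂ} (hs : s.re = -1 / 2) :
    ‖rayClassGammaFactor K p (1 - s)‖ = ‖rayClassGammaFactor K p s‖ *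
      ((∏ w : {w : InfinitePlace K // IsReal w},
          ‖s + 2 * (NumberField.halfWeight K p w.1 : ℂ)‖ / (2 * Real.pi)) *
        ∏ _w : {w : InfinitePlace K // IsComplex w}, ‖s‖ * ‖s + 1‖ / (2 * Real.pi) ^ 2) := by
  obtain ⟨hsZ, hs0, hs1⟩ := ne_int_of_re_eq_neg_half hs
  have h1s : 1 - s = starRingEnd ℂ s + 2 := Complex.ext (by simp [hs]; norm_num) (by simp)
  unfold rayClassGammaFactor
  rw [norm_mul, norm_mul, Complex.norm_prod, Complex.norm_prod, Complex.norm_prod, Complex.norm_prod, h1s]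
  have hreal : ∀ w : {w : InfinitePlace K // IsReal w},
      ‖Gammaℝ (starRingEnd ℂ s + 2 + 2 * (NumberField.halfWeight K p w.1 : ℂ))‖ =
        ‖Gammaℝ (s + 2 * (NumberField.halfWeight K p w.1 : ℂ))‖ *
          (‖s + 2 * (NumberField.halfWeight K p w.1 : ℂ)‖ / (2 * Real.pi)) := by
    intro w
    have hne : s + 2 * (NumberField.halfWeight K p w.1 : ℂ) ≠ 0 := by
      intro h
      have h1 := congrArg Complex.re h
      simp only [Complex.add_re, hs, Complex.mul_re, Complex.ofReal_re, Complex.ofReal_im, Complex.zero_re] at h1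
      norm_num at h1
      have hh : NumberField.halfWeight K p w.1 = 0 ∨ NumberField.halfWeight K p w.1 = 1 / 2 := by
        unfold NumberField.halfWeight; split_ifs <;> simp
      rcases hh with h0 | h0 <;> rw [h0] at h1 <;> norm_num at h1
    have hconj : starRingEnd ℂ s + 2 + 2 * (NumberField.halfWeight K p w.1 : ℂ) =
        starRingEnd ℂ (s + 2 * (NumberField.halfWeight K p w.1 : ℂ)) + 2 := by
      rw [map_add, map_mul, Complex.conj_ofReal, map_ofNat]; ring
    rw [hconj, norm_Gammaℝ_conj_add_two hne, mul_div_assoc]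
  have hcplx : ‖Gammaℂ (starRingEnd ℂ s + 2)‖ = ‖Gammaℂ s‖ * (‖s‖ * ‖s + 1‖ / (2 * Real.pi) ^ 2) := by
    rw [norm_Gammaℂ_conj_add_two hs0 hs1]; ring
  rw [Finset.prod_congr rfl fun w _ ↦ hreal w, Finset.prod_congr rfl fun w _ ↦ hcplx,
    Finset.prod_mul_distrib, Finset.prod_mul_distrib]
  ring

/-! ### The continuation off `{0, 1}` and the functional equation -/

/-- **Any entire continuation of `L(χ, ·)` satisfies `L(s) = W Λ'(1 − s) L_∞(χ,s)⁻¹ (|d_K|𝔑𝔪)^{-s/2}` off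
`{0, 1}`** (in particular `L` vanishes at the poles of `L_∞`, the trivial zeros), where `W`, `Λ'` are Hecke's root number and the continuation of `Λ(χ̄, ·)`
(`rayClassLSeries_functional_equation'`): identity theorem on the connected open set `ℂ ∖ {0, 1}` applied
to `L` and `Λ(χ, ·) · L_∞(χ, ·)⁻¹ (|d_K|𝔑𝔪)^{−s/2}`, then `Λ(χ, s) = W Λ'(1 − s)`.
[cite: NeukirchANT1999, Ch. VII §8 (8.6) Corollary] -/
theorem continuation_eq_of_ne (hψ : IsRayClassCharacter 𝔪 ψ) (hprim : IsPrimitive 𝔪 ψ)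
    (hp : IsSignType 𝔪 ψ p) (h𝔪 : 𝔪 ≠ ⊥) {L : ℂ → ℂ} (hL : Differentiable ℂ L)
    (hLs : ∀ s : ℂ, 1 < s.re → L s = rayClassLSeries 𝔪 ψ s) :
    ∃ (W : ℂ) (Λ' : ℂ → ℂ), ‖W‖ = 1 ∧ (∀ s : ℂ, 1 < s.re → Λ' s = completedRayClassL K 𝔪 (star ψ) p s) ∧
      ∀ s : ℂ, s ≠ 0 → s ≠ 1 →
        L s = W * Λ' (1 - s) * ((rayClassGammaFactor K p s)⁻¹ *
          ((((|(discr K : ℝ)| * (Ideal.absNorm 𝔪 : ℝ) : ℝ)) : ℂ) ^ (s / 2))⁻¹) := by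
  obtain ⟨W, Λ, Λ', hW, -, -, hΛd, -, hΛ, hΛ', hfe⟩ := rayClassLSeries_functional_equation' hψ hprim hp h𝔪
  refine ⟨W, Λ', hW, hΛ', fun s hs0 hs1 ↦ ?_⟩
  set A : ℝ := |(discr K : ℝ)| * (Ideal.absNorm 𝔪 : ℝ) with hA
  have hApos : 0 < A := by
    have hd : 0 < |(discr K : ℝ)| := abs_pos.mpr (by exact_mod_cast discr_ne_zero K)
    have hm : (0 : ℝ) < Ideal.absNorm 𝔪 := by
      exact_mod_cast Nat.pos_of_ne_zero (by rwa [ne_eq, Ideal.absNorm_eq_zero_iff])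
    positivity
  have hA0 : ((A : ℝ) : ℂ) ≠ 0 := Complex.ofReal_ne_zero.mpr hApos.ne'
  -- the holomorphic function `F = Λ · L_∞⁻¹ · A^{-s/2}` on `ℂ ∖ {0,1}`
  set F : ℂ → ℂ := fun s ↦ Λ s * ((rayClassGammaFactor K p s)⁻¹ * (((A : ℝ) : ℂ) ^ (s / 2))⁻¹) with hF
  have hU : IsOpen (({0, 1} : Set ℂ)ᶜ) := (Set.toFinite _).isClosed.isOpen_compl
  have hpc : IsPreconnected (({0, 1} : Set ℂ)ᶜ) :=
    ((Set.toFinite ({0, 1} : Set ℂ)).countable.isPathConnected_compl_of_one_lt_rank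
      (Complex.rank_real_complex ▸ Nat.one_lt_ofNat)).isConnected.isPreconnected
  have hcpow : Differentiable ℂ fun s : ℂ ↦ (((A : ℝ) : ℂ) ^ (s / 2))⁻¹ := by
    have : (fun s : ℂ ↦ (((A : ℝ) : ℂ) ^ (s / 2))⁻¹) = fun s ↦ ((A : ℝ) : ℂ) ^ (-(s / 2)) := by
      funext s; rw [Complex.cpow_neg]
    rw [this]
    exact differentiable_id.div_const 2 |>.neg.const_cpow (Or.inl hA0)
  have hFd : DifferentiableOn ℂ F (({0, 1} : Set ℂ)ᶜ) :=
    hΛd.mul (((differentiable_inv_rayClassGammaFactor K p).mul hcpow).differentiableOn)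
  have hne2 : (2 : ℂ) ∈ (({0, 1} : Set ℂ)ᶜ) := by norm_num
  have heq : EqOn L F (({0, 1} : Set ℂ)ᶜ) := by
    refine AnalyticOnNhd.eqOn_of_preconnected_of_eventuallyEq (𝕜 := ℂ) (hL.differentiableOn.analyticOnNhd hU)
      (hFd.analyticOnNhd hU) hpc hne2 ?_
    refine eventually_of_mem ((continuous_re.isOpen_preimage _ isOpen_Ioi).mem_nhds (by simp : 1 < (2 : ℂ).re))
      fun t (ht : 1 < t.re) ↦ ?_
    have hγ0 : rayClassGammaFactor K p t ≠ 0 := rayClassGammaFactor_ne_zero_of_re_pos p (by linarith)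
    have hc0 : ((A : ℝ) : ℂ) ^ (t / 2) ≠ 0 := by
      rw [Ne, cpow_eq_zero_iff, not_and_or]; exact Or.inl hA0
    rw [hF]
    dsimp only
    rw [hΛ t ht, completedRayClassL, ← hA, hLs t ht]
    field_simp
  have hsU : s ∈ (({0, 1} : Set ℂ)ᶜ) := by simp [hs0, hs1]
  have hLF := heq hsU
  have hΛs : Λ s = W * Λ' (1 - s) := by simpa using hfe (1 - s)
  rw [hLF, hF]
  dsimp only
  rw [hΛs]

/-- **The functional equation on `Re s = −1/2`, in modulus** (Hecke–Rademacher): for a primitive ray class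
character `χ mod 𝔪` of sign type `p`, any entire continuation `L` of `L(χ, ·)` and `Re s = −1/2`:
`|L(s)| = |d_K| 𝔑(𝔪) · ∏_{w real} |s + p_w|/2π · ∏_{w complex} |s||s+1|/(2π)² · |L(χ̄, 1 − s)|`.
[cite: Rademacher1959, §5 Theorem 5 (proof)] [cite: NeukirchANT1999, Ch. VII §8 (8.6) Corollary] -/
theorem norm_continuation_eq_of_re_eq_neg_half (hψ : IsRayClassCharacter 𝔪 ψ) (hprim : IsPrimitive 𝔪 ψ)
    (hp : IsSignType 𝔪 ψ p) (h𝔪 : 𝔪 ≠ ⊥) {L : ℂ → ℂ} (hL : Differentiable ℂ L)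
    (hLs : ∀ s : ℂ, 1 < s.re → L s = rayClassLSeries 𝔪 ψ s) {s : ℂ} (hs : s.re = -1 / 2) :
    ‖L s‖ = (|(discr K : ℝ)| * (Ideal.absNorm 𝔪 : ℝ)) *
      ((∏ w : {w : InfinitePlace K // IsReal w},
          ‖s + 2 * (NumberField.halfWeight K p w.1 : ℂ)‖ / (2 * Real.pi)) *
        ∏ _w : {w : InfinitePlace K // IsComplex w}, ‖s‖ * ‖s + 1‖ / (2 * Real.pi) ^ 2) *
      ‖rayClassLSeries 𝔪 (star ψ) (1 - s)‖ := by
  obtain ⟨W, Λ', hW, hΛ', hid⟩ := continuation_eq_of_ne hψ hprim hp h𝔪 hL hLs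
  obtain ⟨hsZ, hs0, -⟩ := ne_int_of_re_eq_neg_half hs
  have hs1 : s ≠ 1 := fun h ↦ hsZ 1 (by simpa using h)
  have h1s : 1 < (1 - s).re := by simp [hs]; norm_num
  set A : ℝ := |(discr K : ℝ)| * (Ideal.absNorm 𝔪 : ℝ) with hA
  have hApos : 0 < A := by
    have hd : 0 < |(discr K : ℝ)| := abs_pos.mpr (by exact_mod_cast discr_ne_zero K)
    have hm : (0 : ℝ) < Ideal.absNorm 𝔪 := by
      exact_mod_cast Nat.pos_of_ne_zero (by rwa [ne_eq, Ideal.absNorm_eq_zero_iff])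
    positivity
  set R : ℝ := (∏ w : {w : InfinitePlace K // IsReal w},
      ‖s + 2 * (NumberField.halfWeight K p w.1 : ℂ)‖ / (2 * Real.pi)) *
    ∏ _w : {w : InfinitePlace K // IsComplex w}, ‖s‖ * ‖s + 1‖ / (2 * Real.pi) ^ 2 with hR
  have hre1 : ((1 - s) / 2).re = (3 / 4 : ℝ) := by simp [hs]; norm_num
  have hre2 : (s / 2).re = (-1 / 4 : ℝ) := by simp [hs]; norm_num
  have hγ : ‖rayClassGammaFactor K p s‖ ≠ 0 :=
    norm_ne_zero_iff.mpr (rayClassGammaFactor_ne_zero_of_re_eq_neg_half p hs)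
  have hA34 : A ^ (3 / 4 : ℝ) * (A ^ (-1 / 4 : ℝ))⁻¹ = A := by
    rw [← Real.rpow_neg hApos.le, ← Real.rpow_add hApos]; norm_num
  rw [hid s hs0 hs1, hΛ' (1 - s) h1s, completedRayClassL, ← hA]
  rw [norm_mul, norm_mul, norm_mul, norm_mul, norm_mul, norm_inv, norm_inv, hW, one_mul,
    Complex.norm_cpow_eq_rpow_re_of_pos hApos, Complex.norm_cpow_eq_rpow_re_of_pos hApos,
    norm_rayClassGammaFactor_one_sub_of_re_eq_neg_half p hs, ← hR, hre1, hre2]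
  calc A ^ (3 / 4 : ℝ) * (‖rayClassGammaFactor K p s‖ * R) * ‖rayClassLSeries 𝔪 (star ψ) (1 - s)‖ *
        (‖rayClassGammaFactor K p s‖⁻¹ * (A ^ (-1 / 4 : ℝ))⁻¹)
      = (A ^ (3 / 4 : ℝ) * (A ^ (-1 / 4 : ℝ))⁻¹) * (‖rayClassGammaFactor K p s‖ * ‖rayClassGammaFactor K p s‖⁻¹) *
          R * ‖rayClassLSeries 𝔪 (star ψ) (1 - s)‖ := by ring
    _ = A * R * ‖rayClassLSeries 𝔪 (star ψ) (1 - s)‖ := by rw [hA34, mul_inv_cancel₀ hγ, mul_one]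

/-- `‖s + a‖ ≤ ‖s + 5/2‖` for real `0 ≤ a ≤ 1` on `Re s = −1/2`. [folklore] -/
private theorem norm_add_le_norm_add_five_halves {s : ℂ} (hs : s.re = -1 / 2) {a : ℝ} (ha0 : 0 ≤ a) (ha1 : a ≤ 1) :
    ‖s + (a : ℂ)‖ ≤ ‖s + 5 / 2‖ := by
  refine norm_le_norm_of_sq_le ?_
  have h1 : (s + (a : ℂ)).re = -1 / 2 + a := by rw [Complex.add_re, Complex.ofReal_re, hs]
  have h2 : (s + (a : ℂ)).im = s.im := by rw [Complex.add_im, Complex.ofReal_im, add_zero]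
  have h3 : (s + 5 / 2).re = 2 := by
    rw [Complex.add_re, hs, show (5 / 2 : ℂ) = ((5 / 2 : ℝ) : ℂ) by push_cast; ring, Complex.ofReal_re]; norm_num
  have h4 : (s + 5 / 2).im = s.im := by
    rw [Complex.add_im, show (5 / 2 : ℂ) = ((5 / 2 : ℝ) : ℂ) by push_cast; ring, Complex.ofReal_im, add_zero]
  rw [h1, h2, h3, h4]
  nlinarith

set_option maxHeartbeats 800000 in
/-- **The left edge**: for `Re s = −1/2` and any entire continuation `L` of `L(χ, ·)`:
`|L(s)| ≤ |d_K| 𝔑(𝔪) · e^{2 n_K} · |s + 5/2|^{n_K}`. [cite: Rademacher1959, §5 Theorem 5] -/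
theorem norm_continuation_le_of_re_eq_neg_half (hψ : IsRayClassCharacter 𝔪 ψ) (hprim : IsPrimitive 𝔪 ψ)
    (hp : IsSignType 𝔪 ψ p) (h𝔪 : 𝔪 ≠ ⊥) {L : ℂ → ℂ} (hL : Differentiable ℂ L)
    (hLs : ∀ s : ℂ, 1 < s.re → L s = rayClassLSeries 𝔪 ψ s) {s : ℂ} (hs : s.re = -1 / 2) :
    ‖L s‖ ≤ (|(discr K : ℝ)| * (Ideal.absNorm 𝔪 : ℝ)) * Real.exp (2 * Module.finrank ℚ K) *
      ‖s + 5 / 2‖ ^ Module.finrank ℚ K := by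
  rw [norm_continuation_eq_of_re_eq_neg_half hψ hprim hp h𝔪 hL hLs hs]
  set N : ℝ := ‖s + 5 / 2‖ with hN
  have hN2 : 2 ≤ N := by
    have h3 : (s + 5 / 2).re = 2 := by
      rw [Complex.add_re, hs, show (5 / 2 : ℂ) = ((5 / 2 : ℝ) : ℂ) by push_cast; ring, Complex.ofReal_re]; norm_num
    calc (2 : ℝ) = |(s + 5 / 2).re| := by rw [h3]; norm_num
      _ ≤ ‖s + 5 / 2‖ := abs_re_le_norm _
  have hN0 : 0 ≤ N := by linarith
  have hpi : 1 ≤ 2 * Real.pi := by linarith [Real.pi_gt_three]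
  have hApos : 0 < |(discr K : ℝ)| * (Ideal.absNorm 𝔪 : ℝ) := by
    have hd : 0 < |(discr K : ℝ)| := abs_pos.mpr (by exact_mod_cast discr_ne_zero K)
    have hm : (0 : ℝ) < Ideal.absNorm 𝔪 := by
      exact_mod_cast Nat.pos_of_ne_zero (by rwa [ne_eq, Ideal.absNorm_eq_zero_iff])
    positivity
  -- each real-place factor `≤ N`, each complex-place factor `≤ N²`
  have hreal : ∀ w : {w : InfinitePlace K // IsReal w},
      ‖s + 2 * (NumberField.halfWeight K p w.1 : ℂ)‖ / (2 * Real.pi) ≤ N := by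
    intro w
    have hh : NumberField.halfWeight K p w.1 = 0 ∨ NumberField.halfWeight K p w.1 = 1 / 2 := by
      unfold NumberField.halfWeight; split_ifs <;> simp
    have h1 : ‖s + 2 * (NumberField.halfWeight K p w.1 : ℂ)‖ ≤ N := by
      rcases hh with h0 | h0 <;> rw [h0]
      · simpa using norm_add_le_norm_add_five_halves hs (a := 0) le_rfl zero_le_one
      · have := norm_add_le_norm_add_five_halves hs (a := 1) zero_le_one le_rfl
        convert this using 2; push_cast; ring
    rw [div_le_iff₀ (by positivity)]
    calc ‖s + 2 * (NumberField.halfWeight K p w.1 : ℂ)‖ ≤ N := h1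
      _ = N * 1 := (mul_one N).symm
      _ ≤ N * (2 * Real.pi) := by gcongr
  have hcplx : ‖s‖ * ‖s + 1‖ / (2 * Real.pi) ^ 2 ≤ N ^ 2 := by
    have h1 : ‖s‖ ≤ N := by simpa using norm_add_le_norm_add_five_halves hs (a := 0) le_rfl zero_le_one
    have h2 : ‖s + 1‖ ≤ N := by
      have := norm_add_le_norm_add_five_halves hs (a := 1) zero_le_one le_rfl
      simpa using this
    rw [div_le_iff₀ (by positivity)]
    calc ‖s‖ * ‖s + 1‖ ≤ N * N := mul_le_mul h1 h2 (norm_nonneg _) hN0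
      _ = N ^ 2 * 1 := by ring
      _ ≤ N ^ 2 * (2 * Real.pi) ^ 2 := by gcongr; nlinarith
  have hprodR : (∏ w : {w : InfinitePlace K // IsReal w},
      ‖s + 2 * (NumberField.halfWeight K p w.1 : ℂ)‖ / (2 * Real.pi)) ≤ N ^ nrRealPlaces K := by
    calc (∏ w : {w : InfinitePlace K // IsReal w}, ‖s + 2 * (NumberField.halfWeight K p w.1 : ℂ)‖ / (2 * Real.pi))
        ≤ ∏ _w : {w : InfinitePlace K // IsReal w}, N :=
          Finset.prod_le_prod (fun w _ ↦ by positivity) (fun w _ ↦ hreal w)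
      _ = N ^ nrRealPlaces K := by rw [Finset.prod_const]; rfl
  have hprodC : (∏ _w : {w : InfinitePlace K // IsComplex w}, ‖s‖ * ‖s + 1‖ / (2 * Real.pi) ^ 2) ≤
      (N ^ 2) ^ nrComplexPlaces K := by
    calc (∏ _w : {w : InfinitePlace K // IsComplex w}, ‖s‖ * ‖s + 1‖ / (2 * Real.pi) ^ 2)
        ≤ ∏ _w : {w : InfinitePlace K // IsComplex w}, N ^ 2 :=
          Finset.prod_le_prod (fun w _ ↦ by positivity) (fun w _ ↦ hcplx)
      _ = (N ^ 2) ^ nrComplexPlaces K := by rw [Finset.prod_const]; rfl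
  have h1s : 1 < (1 - s).re := by simp [hs]; norm_num
  have hL' : ‖rayClassLSeries 𝔪 (star ψ) (1 - s)‖ ≤ Real.exp (2 * Module.finrank ℚ K) := by
    refine (norm_rayClassLSeries_le_exp h𝔪 (fun v hv ↦ (hψ.star.norm_eq_one v hv).le) h1s).trans (le_of_eq ?_)
    congr 1
    simp [hs]; ring
  have hrank : nrRealPlaces K + 2 * nrComplexPlaces K = Module.finrank ℚ K := card_add_two_mul_card_eq_rank K
  calc (|(discr K : ℝ)| * (Ideal.absNorm 𝔪 : ℝ)) *
        ((∏ w : {w : InfinitePlace K // IsReal w},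
            ‖s + 2 * (NumberField.halfWeight K p w.1 : ℂ)‖ / (2 * Real.pi)) *
          ∏ _w : {w : InfinitePlace K // IsComplex w}, ‖s‖ * ‖s + 1‖ / (2 * Real.pi) ^ 2) *
        ‖rayClassLSeries 𝔪 (star ψ) (1 - s)‖
      ≤ (|(discr K : ℝ)| * (Ideal.absNorm 𝔪 : ℝ)) * (N ^ nrRealPlaces K * (N ^ 2) ^ nrComplexPlaces K) *
          Real.exp (2 * Module.finrank ℚ K) := by
        have hPC0 : 0 ≤ ∏ _w : {w : InfinitePlace K // IsComplex w}, ‖s‖ * ‖s + 1‖ / (2 * Real.pi) ^ 2 :=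
          Finset.prod_nonneg fun w _ ↦ by positivity
        have hNr : 0 ≤ N ^ nrRealPlaces K := by positivity
        have h12 := mul_le_mul hprodR hprodC hPC0 hNr
        exact mul_le_mul (mul_le_mul_of_nonneg_left h12 hApos.le) hL' (norm_nonneg _) (by positivity)
    _ = (|(discr K : ℝ)| * (Ideal.absNorm 𝔪 : ℝ)) * Real.exp (2 * Module.finrank ℚ K) *
          N ^ (nrRealPlaces K + 2 * nrComplexPlaces K) := by ring
    _ = _ := by rw [hrank]

end Literature.NumberTheory.LFunctions
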